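import Literature.NumberTheory.DiophantineGeometry.MultiplicativeGroupApproximationReductionProofs
import HarnessLib

/-!
# Evertse–Győry, Theorem 4.2.1 over `ℚ`: reduction to the theorems of Matveev and Yu

Topic `NumberTheory/DiophantineGeometry`; namespace
`Literature.NumberTheory.DiophantineGeometry.Dioph`.
Companion of `MultiplicativeGroupApproximation.lean` (the named fact `evertseGyory_thm_4_2_1_rat`,
Evertse–Győry's Theorem 4.2.1 for `K = ℚ`) and of `…ReductionProofs.lean`, which proves
Theorem 4.2.1 over `ℚ` from the statement of Evertse–Győry's **Theorem 3.2.8** for `K = ℚ`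
(`evertseGyory_thm_4_2_1_rat_of_thm_3_2_8`).

In the book (p. 62–63) Theorem 3.2.8 is itself a consequence of two external theorems — the only
inputs of the whole proof of Theorem 4.2.1 that are not proved in the book:

* **Theorem 3.2.4** (p. 61) = Matveev (2000), Corollary 2.3: the lower bound
  `log |Σ| > −C₁(n, d) A₁ ⋯ Aₙ log(eB)` for a non-vanishing linear form
  `Σ = b₁ log α₁ + ⋯ + bₙ log αₙ` in logarithms of algebraic numbers, with
  `C₁(n, d) = min{(1/χ)(½en)^χ 30^{n+3} n^{3.5}, 2^{6n+20}} d² log(ed)`;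
* **Theorem 3.2.7** (p. 62) = Yu (2007), second consequence of the Main Theorem: the upper bound
  (3.2.6) for `ord_𝔭(α₁^{b₁} ⋯ αₙ^{bₙ} − 1)` with the constants `C₃, C₄, C₅`.

This file PROVES the book's derivation of Theorem 3.2.8 from these two theorems in the case
`K = ℚ`, `d = 1` ("Proof of Theorem 3.2.8", p. 63: the infinite place from Theorem 3.2.4, the
finite places from Theorem 3.2.7 with `δ = h'₁⋯h'ₙ₋₁H/B`, `Bₙ = 1`, "after some computation"),
and records the resulting **conditional theorem**
`evertseGyory_thm_4_2_1_rat_of_matveev_yu`: Theorem 4.2.1 for `K = ℚ` follows from the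
statements of Theorem 3.2.4 and Theorem 3.2.7 for `K = ℚ`, which appear as explicit hypotheses
(spelled out in the binders `hM`, `hY`; see the docstrings of `thm328_rat_infinite_of_matveev`
and `thm328_rat_finite_of_yu` for the dictionary with the printed statements). No named fact is
introduced and no definition is added (the constants `C₁, C₃, C₄, C₅` for `d = 1` are written
out); the named fact `evertseGyory_thm_4_2_1_rat` stays undischarged, its remaining debt being
now precisely Matveev's and Yu's theorems over `ℚ` (Baker's theory, not available in Lean).

Deviations from the printed page, all inside the proofs: (i) at the infinite place we apply
Theorem 3.2.4 directly to the real logarithms `log |αᵢ|` (over `ℚ` one has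
`log |Λ|_∞ = log |P − 1|` with `P = α₁^{b₁}⋯αₙ^{bₙ} ∈ ℚ`, and for `|P − 1| ≤ ½` the number
`log P = Σ bᵢ log |αᵢ|` is a real linear form in logarithms of positive rationals), instead of
passing through Theorem 3.2.5 and `α₀ = −1`; when `|αₙ| = 1` the `n`-th slot is `(2, bₙ := 0)`.
With `Aᵢ = h(αᵢ)` (`i < n`), `Aₙ = H` and `B_Matveev ≤ (B/H)²` the comparison of constants is
`3 · 2^{6n+20} + 2^{n−1} ≤ 2 · 2^{15n+10} ≤ (2/log 2) C₆(n, 1)`. (ii) At the finite places the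
"some computation" is: `max{h'₁⋯h'ₙ log(M/δ), δB/(BₙC₄)} ≤ 7(n+1)² Θ H log*(pB/H)` and
`C₃(n,1) · 7(n+1)² ≤ (16e)^{2n+2} · 14(n+1)⁵ ≤ λ (16e)^{3n+2} = C₆(n, 1)` (using `λ = 12` for
`n = 2`).

## References

* [EvertseGyory2015] J.-H. Evertse, K. Győry, *Unit Equations in Diophantine Number Theory*,
  Cambridge Stud. Adv. Math. 146, CUP 2015 — Thm 3.2.4 (p. 61), Thm 3.2.7 (p. 62), Thm 3.2.8
  (p. 62) and its proof (p. 63), Prop 3.2.9 (p. 62), Thm 4.2.1 (p. 68).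
* [Matveev2000] E. M. Matveev, *An explicit lower bound for a homogeneous rational linear form in
  logarithms of algebraic numbers. II*, Izv. Math. 64 (2000), 1217–1269 — Cor. 2.3.
* [Yu2007] K. Yu, *p-adic logarithmic forms and group varieties. III*, Forum Math. 19 (2007),
  187–280 — Main Theorem, second consequence.
-/

open Height Real Finset

noncomputable section

namespace Literature.NumberTheory.DiophantineGeometry.Dioph

/-! ### Elementary lemmas over `ℚ` and numerical constants -/

/-- `log |z| ≤ h(z)` for `z ∈ ℚ*` (`|a/b| ≤ |a| ≤ H(a/b)`). [folklore] -/
theorem log_abs_le_logHeight₁ {z : ℚ} (hz : z ≠ 0) :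
    Real.log |((z : ℚ) : ℝ)| ≤ logHeight₁ z := by
  rw [Rat.logHeight₁_eq_log_max]
  have hden : (1 : ℝ) ≤ z.den := by exact_mod_cast z.den_pos
  have hcast : ((z : ℚ) : ℝ) = (z.num : ℝ) / (z.den : ℝ) := Rat.cast_def z
  have habs : |((z : ℚ) : ℝ)| ≤ ((max z.num.natAbs z.den : ℕ) : ℝ) := by
    rw [hcast, abs_div, abs_of_pos (by positivity : (0 : ℝ) < z.den)]
    calc |(z.num : ℝ)| / z.den ≤ |(z.num : ℝ)| := div_le_self (abs_nonneg _) hden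
      _ = (z.num.natAbs : ℝ) := by rw [Nat.cast_natAbs, Int.cast_abs]
      _ ≤ _ := by exact_mod_cast le_max_left _ _
  have hpos : 0 < |((z : ℚ) : ℝ)| := abs_pos.mpr (by exact_mod_cast hz)
  exact Real.log_le_log hpos habs

/-- `|log |z|| ≤ h(z)` for `z ∈ ℚ*`. [folklore] -/
theorem abs_log_abs_le_logHeight₁ {z : ℚ} (hz : z ≠ 0) :
    |Real.log (|((z : ℚ) : ℝ)|)| ≤ logHeight₁ z :=
  abs_le.mpr ⟨by linarith [neg_logHeight₁_le_log_abs hz], log_abs_le_logHeight₁ hz⟩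

/-- `h(|x|) = h(x)` on `ℚ`. [folklore] -/
theorem logHeight₁_abs (x : ℚ) : logHeight₁ |x| = logHeight₁ x := by
  rcases abs_choice x with h | h
  · rw [h]
  · rw [h]; exact logHeight₁_neg x

/-- `h(2) = log 2`. [folklore] -/
theorem logHeight₁_two : logHeight₁ (2 : ℚ) = Real.log 2 := by
  rw [Rat.logHeight₁_eq_log_max]
  norm_num

/-- `43 ≤ 16e`. [folklore] -/
theorem fortythree_le : (43 : ℝ) ≤ 16 * Real.exp 1 := by
  have := Real.exp_one_gt_d9; linarith

/-- `2^{15n+10} ≤ C₆(n, 1)` (`λ ≥ 1`, `16e ≥ 32`). [folklore] -/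
theorem two_pow_le_egC6 (n : ℕ) : (2 : ℝ) ^ (15 * n + 10) ≤ egC6 n := by
  rw [egC6_def]
  have hlam : (1 : ℝ) ≤ (if n = 2 then (12 : ℝ) else 1) := by split_ifs <;> norm_num
  have h32 : (32 : ℝ) ≤ 16 * Real.exp 1 := by linarith [Real.add_one_le_exp (1 : ℝ)]
  calc (2 : ℝ) ^ (15 * n + 10) = 32 ^ (3 * n + 2) := by
        rw [show (32 : ℝ) = 2 ^ 5 by norm_num, ← pow_mul]; ring_nf
    _ ≤ (16 * Real.exp 1) ^ (3 * n + 2) := pow_le_pow_left₀ (by norm_num) h32 _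
    _ = 1 * (16 * Real.exp 1) ^ (3 * n + 2) := (one_mul _).symm
    _ ≤ _ := mul_le_mul_of_nonneg_right hlam (by positivity)

/-- The comparison of constants at the infinite place (`n = m + 1`):
`3 · 2^{6n+20} Θ H L + log 2 ≤ C₆(n,1) (2/log 2) Θ H L` for `Θ ≥ (1/2)^m`, `H, L ≥ 1`.
[folklore] -/
theorem const_infinite_bound (m : ℕ) (hm : 1 ≤ m) {Θ H L : ℝ} (hΘ : (1 / 2 : ℝ) ^ m ≤ Θ)
    (hH : 1 ≤ H) (hL : 1 ≤ L) :
    3 * 2 ^ (6 * (m + 1) + 20) * Θ * H * L + Real.log 2 ≤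
      egC6 (m + 1) * (2 / Real.log 2) * Θ * H * L := by
  have hlog2 : 0 < Real.log 2 := Real.log_pos one_lt_two
  have hl2 : Real.log 2 ≤ 1 := by have := Real.log_two_lt_d9; linarith
  have hΘ0 : 0 < Θ := lt_of_lt_of_le (by positivity) hΘ
  have hΘHL : (1 / 2 : ℝ) ^ m ≤ Θ * H * L := by
    calc (1 / 2 : ℝ) ^ m ≤ Θ := hΘ
      _ = Θ * 1 * 1 := by ring
      _ ≤ Θ * H * L := mul_le_mul (mul_le_mul_of_nonneg_left hH hΘ0.le) hL zero_le_one
          (by positivity)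
  -- log 2 ≤ 1 ≤ 2^m Θ H L
  have h1 : Real.log 2 ≤ 2 ^ m * (Θ * H * L) := by
    have : (1 : ℝ) ≤ 2 ^ m * (1 / 2 : ℝ) ^ m := by
      rw [← mul_pow]; norm_num
    calc Real.log 2 ≤ 1 := hl2
      _ ≤ 2 ^ m * (1 / 2 : ℝ) ^ m := this
      _ ≤ 2 ^ m * (Θ * H * L) := mul_le_mul_of_nonneg_left hΘHL (by positivity)
  -- 2/log 2 ≥ 2 and C₆ ≥ 2^{15n+10}
  have h2 : (2 : ℝ) ≤ 2 / Real.log 2 := by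
    rw [le_div_iff₀ hlog2]; nlinarith
  have hC6 := two_pow_le_egC6 (m + 1)
  have h3 : (2 : ℝ) ^ (15 * (m + 1) + 10) * 2 * (Θ * H * L) ≤
      egC6 (m + 1) * (2 / Real.log 2) * Θ * H * L := by
    calc (2 : ℝ) ^ (15 * (m + 1) + 10) * 2 * (Θ * H * L)
        ≤ egC6 (m + 1) * (2 / Real.log 2) * (Θ * H * L) := by
          apply mul_le_mul_of_nonneg_right _ (by positivity)
          exact mul_le_mul hC6 h2 zero_le_two (egC6_nonneg _)
      _ = _ := by ring
  -- powers of two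
  have h4 : (3 : ℝ) * 2 ^ (6 * (m + 1) + 20) + 2 ^ m ≤ 2 ^ (15 * (m + 1) + 10) * 2 := by
    have he : (2 : ℝ) ^ (6 * m + 28) = 2 ^ (6 * (m + 1) + 20) * 2 ^ 2 := by
      rw [← pow_add]; ring_nf
    have ha : (3 : ℝ) * 2 ^ (6 * (m + 1) + 20) ≤ 2 ^ (6 * m + 28) := by
      rw [he]
      have := pow_pos (two_pos : (0 : ℝ) < 2) (6 * (m + 1) + 20)
      nlinarith
    have hb : (2 : ℝ) ^ m ≤ 2 ^ (6 * m + 28) := pow_le_pow_right₀ one_le_two (by omega)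
    have hc : (2 : ℝ) ^ (6 * m + 28) * 2 ≤ 2 ^ (15 * (m + 1) + 10) := by
      rw [← pow_succ]; exact pow_le_pow_right₀ one_le_two (by omega)
    have hd := pow_pos (two_pos : (0 : ℝ) < 2) (15 * (m + 1) + 10)
    linarith
  calc 3 * 2 ^ (6 * (m + 1) + 20) * Θ * H * L + Real.log 2
      ≤ 3 * 2 ^ (6 * (m + 1) + 20) * (Θ * H * L) + 2 ^ m * (Θ * H * L) := by nlinarith
    _ = (3 * 2 ^ (6 * (m + 1) + 20) + 2 ^ m) * (Θ * H * L) := by ring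
    _ ≤ 2 ^ (15 * (m + 1) + 10) * 2 * (Θ * H * L) :=
        mul_le_mul_of_nonneg_right h4 (by positivity)
    _ ≤ _ := h3

/-- `14 (n+1)^5 ≤ 43^n` for `n ≥ 3` (natural numbers). [folklore] -/
theorem fourteen_mul_pow_five_le (n : ℕ) (hn : 3 ≤ n) : 14 * (n + 1) ^ 5 ≤ 43 ^ n := by
  induction n, hn using Nat.le_induction with
  | base => norm_num
  | succ n hn ih =>
    -- (n+2)^5 ≤ 4 (n+1)^5 for n ≥ 3
    have hstep : (n + 2) ^ 5 ≤ 4 * (n + 1) ^ 5 := by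
      have h1 : 4 * (n + 2) ≤ 5 * (n + 1) := by omega
      have h2 : (4 * (n + 2)) ^ 5 ≤ (5 * (n + 1)) ^ 5 := Nat.pow_le_pow_left h1 5
      have h3 : 1024 * (n + 2) ^ 5 ≤ 1024 * (4 * (n + 1) ^ 5) := by
        calc 1024 * (n + 2) ^ 5 = (4 * (n + 2)) ^ 5 := by ring
          _ ≤ (5 * (n + 1)) ^ 5 := h2
          _ = 3125 * (n + 1) ^ 5 := by ring
          _ ≤ 4096 * (n + 1) ^ 5 := Nat.mul_le_mul_right _ (by norm_num)
          _ = 1024 * (4 * (n + 1) ^ 5) := by ring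
      exact Nat.le_of_mul_le_mul_left h3 (by norm_num)
    calc 14 * (n + 1 + 1) ^ 5 = 14 * (n + 2) ^ 5 := by ring
      _ ≤ 14 * (4 * (n + 1) ^ 5) := Nat.mul_le_mul_left _ hstep
      _ = 4 * (14 * (n + 1) ^ 5) := by ring
      _ ≤ 4 * 43 ^ n := Nat.mul_le_mul_left _ ih
      _ ≤ 43 * 43 ^ n := Nat.mul_le_mul_right _ (by norm_num)
      _ = 43 ^ (n + 1) := by ring

/-- `14 (n+1)^5 ≤ λ (16e)^n` for `n ≥ 2`, `λ = 12` if `n = 2`, else `1`. [folklore] -/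
theorem fourteen_mul_pow_five_le_lambda_pow (n : ℕ) (hn : 2 ≤ n) :
    (14 : ℝ) * ((n : ℝ) + 1) ^ 5 ≤ (if n = 2 then (12 : ℝ) else 1) * (16 * Real.exp 1) ^ n := by
  have h43 := fortythree_le
  have hpow : (43 : ℝ) ^ n ≤ (16 * Real.exp 1) ^ n := pow_le_pow_left₀ (by norm_num) h43 n
  by_cases h2 : n = 2
  · subst h2
    simp only [if_true]
    have : (43 : ℝ) ^ 2 ≤ (16 * Real.exp 1) ^ 2 := hpow
    push_cast
    nlinarith
  · rw [if_neg h2, one_mul]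
    have hn3 : 3 ≤ n := by omega
    have hnat := fourteen_mul_pow_five_le n hn3
    have hcast : (14 : ℝ) * ((n : ℝ) + 1) ^ 5 ≤ (43 : ℝ) ^ n := by exact_mod_cast hnat
    exact le_trans hcast hpow

/-- The comparison of constants at the finite places:
`C₃(n,1) · 7(n+1)² ≤ C₆(n,1)` for `n ≥ 2`, where
`C₃(n,1) = (16e)^{2(n+1)} n^{3/2} log(2n) log 2`. [folklore] -/
theorem const_finite_bound (n : ℕ) (hn : 2 ≤ n) :
    (16 * Real.exp 1) ^ (2 * (n + 1)) * (n : ℝ) ^ (3 / 2 : ℝ) * Real.log (2 * n) * Real.log 2 *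
        (7 * ((n : ℝ) + 1) ^ 2) ≤ egC6 n := by
  have hE1 : (1 : ℝ) ≤ 16 * Real.exp 1 := by linarith [fortythree_le]
  have hn1 : (1 : ℝ) ≤ n := by exact_mod_cast (le_trans one_le_two hn)
  have hn0 : (0 : ℝ) < n := by linarith
  have hl2 : Real.log 2 ≤ 1 := by have := Real.log_two_lt_d9; linarith
  have hl20 : 0 ≤ Real.log 2 := Real.log_nonneg one_le_two
  -- n^{3/2} ≤ n^2
  have hrpow : (n : ℝ) ^ (3 / 2 : ℝ) ≤ (n : ℝ) ^ 2 := by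
    calc (n : ℝ) ^ (3 / 2 : ℝ) ≤ (n : ℝ) ^ (2 : ℝ) :=
          Real.rpow_le_rpow_of_exponent_le hn1 (by norm_num)
      _ = (n : ℝ) ^ 2 := Real.rpow_two _
  have hrpow0 : 0 ≤ (n : ℝ) ^ (3 / 2 : ℝ) := Real.rpow_nonneg hn0.le _
  -- log(2n) ≤ 2n
  have hlog2n : Real.log (2 * n) ≤ 2 * n := by
    have := Real.log_le_sub_one_of_pos (by positivity : (0 : ℝ) < 2 * n); linarith
  have hlog2n0 : 0 ≤ Real.log (2 * n) := Real.log_nonneg (by linarith)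
  -- polynomial part ≤ 14 (n+1)^5 ≤ λ (16e)^n
  have hpoly : (n : ℝ) ^ (3 / 2 : ℝ) * Real.log (2 * n) * Real.log 2 * (7 * ((n : ℝ) + 1) ^ 2) ≤
      14 * ((n : ℝ) + 1) ^ 5 := by
    calc (n : ℝ) ^ (3 / 2 : ℝ) * Real.log (2 * n) * Real.log 2 * (7 * ((n : ℝ) + 1) ^ 2)
        ≤ (n : ℝ) ^ 2 * (2 * n) * 1 * (7 * ((n : ℝ) + 1) ^ 2) := by
          apply mul_le_mul_of_nonneg_right _ (by positivity)
          exact mul_le_mul (mul_le_mul hrpow hlog2n hlog2n0 (by positivity)) hl2 hl20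
            (by positivity)
      _ = 14 * ((n : ℝ) ^ 3 * ((n : ℝ) + 1) ^ 2) := by ring
      _ ≤ 14 * (((n : ℝ) + 1) ^ 3 * ((n : ℝ) + 1) ^ 2) := by
          apply mul_le_mul_of_nonneg_left _ (by norm_num)
          apply mul_le_mul_of_nonneg_right _ (by positivity)
          exact pow_le_pow_left₀ hn0.le (by linarith) 3
      _ = 14 * ((n : ℝ) + 1) ^ 5 := by ring
  have hlam := fourteen_mul_pow_five_le_lambda_pow n hn
  have hlam0 : (0 : ℝ) ≤ (if n = 2 then (12 : ℝ) else 1) := by split_ifs <;> norm_num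
  rw [egC6_def]
  calc (16 * Real.exp 1) ^ (2 * (n + 1)) * (n : ℝ) ^ (3 / 2 : ℝ) * Real.log (2 * n) * Real.log 2 *
        (7 * ((n : ℝ) + 1) ^ 2)
      = (16 * Real.exp 1) ^ (2 * (n + 1)) *
          ((n : ℝ) ^ (3 / 2 : ℝ) * Real.log (2 * n) * Real.log 2 * (7 * ((n : ℝ) + 1) ^ 2)) := by
        ring
    _ ≤ (16 * Real.exp 1) ^ (2 * (n + 1)) * ((if n = 2 then (12 : ℝ) else 1) * (16 * Real.exp 1) ^ n) :=
        mul_le_mul_of_nonneg_left (le_trans hpoly hlam) (by positivity)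
    _ = (if n = 2 then (12 : ℝ) else 1) * (16 * Real.exp 1) ^ (3 * n + 2) := by
        rw [show 3 * n + 2 = 2 * (n + 1) + n by ring, pow_add]; ring

/-- `(1/2)^{#ι} ≤ Θ = ∏ h(αᵢ)` for non-torsion `αᵢ ∈ ℚ*` (Prop 3.2.9 for `d = 1` and
`log 2 ≥ ½`). [folklore] -/
theorem half_pow_card_le_prod_logHeight₁ {ι : Type*} [Fintype ι] (α : ι → ℚ)
    (hα : ∀ i, α i ≠ 0 ∧ α i ≠ 1 ∧ α i ≠ -1) :
    (1 / 2 : ℝ) ^ Fintype.card ι ≤ ∏ i, logHeight₁ (α i) := by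
  have hhalf : (1 / 2 : ℝ) ≤ Real.log 2 := by have := Real.log_two_gt_d9; linarith
  have : ∏ _i : ι, (1 / 2 : ℝ) = (1 / 2) ^ Fintype.card ι := by
    rw [Finset.prod_const, Finset.card_univ]
  rw [← this]
  exact Finset.prod_le_prod (fun i _ => by norm_num) fun i _ =>
    le_trans hhalf (log_two_le_logHeight₁ (hα i).1 (hα i).2.1 (hα i).2.2)

/-- Elementary consequences of (3.2.7) for `d = 1`: if `Θ ≥ (1/2)^m`, `H ≥ 1` and
`B ≥ 2e · 9^{m+1} Θ H`, then `2^m Θ ≤ B/H`, `B/H ≥ 1`, `B ≥ 1`, `B > 0` and `2 Θ H ≤ B`.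
[folklore] -/
theorem eg328_prelim (m : ℕ) {Θ H B : ℝ} (hΘ : (1 / 2 : ℝ) ^ m ≤ Θ) (hH : 1 ≤ H)
    (hB : 2 * Real.exp 1 * 9 ^ (m + 1) * Θ * H ≤ B) :
    2 ^ m * Θ ≤ B / H ∧ 1 ≤ B / H ∧ 1 ≤ B ∧ 0 < B ∧ 2 * (Θ * H) ≤ B := by
  have hΘpos : 0 < Θ := lt_of_lt_of_le (by positivity) hΘ
  have hH0 : 0 < H := by linarith
  have he2 : (2 : ℝ) ≤ Real.exp 1 := by linarith [Real.add_one_le_exp (1 : ℝ)]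
  have hBH : 2 * Real.exp 1 * 9 ^ (m + 1) * Θ ≤ B / H := by
    rw [le_div_iff₀ hH0]; linarith
  have h2m : (2 : ℝ) ^ m ≤ 2 * Real.exp 1 * 9 ^ (m + 1) := by
    calc (2 : ℝ) ^ m ≤ 9 ^ m := pow_le_pow_left₀ (by norm_num) (by norm_num) m
      _ = 1 * 9 ^ m := (one_mul _).symm
      _ ≤ (2 * Real.exp 1 * 9) * 9 ^ m := by
          apply mul_le_mul_of_nonneg_right _ (by positivity); nlinarith
      _ = 2 * Real.exp 1 * 9 ^ (m + 1) := by ring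
  have h1 : (2 : ℝ) ^ m * Θ ≤ B / H :=
    le_trans (mul_le_mul_of_nonneg_right h2m hΘpos.le) hBH
  have hone : (1 : ℝ) ≤ 2 ^ m * Θ := by
    calc (1 : ℝ) = 2 ^ m * (1 / 2) ^ m := by rw [← mul_pow]; norm_num
      _ ≤ 2 ^ m * Θ := mul_le_mul_of_nonneg_left hΘ (by positivity)
  have h2 : 1 ≤ B / H := le_trans hone h1
  have h3 : 1 ≤ B := by
    have : 1 * H ≤ B := (le_div_iff₀ hH0).mp h2
    linarith
  have h4 : 0 < B := by linarith
  have h5 : 2 * (Θ * H) ≤ B := by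
    have h91 : (1 : ℝ) ≤ Real.exp 1 * 9 ^ (m + 1) := by
      have : (1 : ℝ) ≤ 9 ^ (m + 1) := one_le_pow₀ (by norm_num)
      nlinarith
    have hΘH : 0 ≤ Θ * H := by positivity
    calc 2 * (Θ * H) = 2 * 1 * (Θ * H) := by ring
      _ ≤ 2 * (Real.exp 1 * 9 ^ (m + 1)) * (Θ * H) := by gcongr
      _ = 2 * Real.exp 1 * 9 ^ (m + 1) * Θ * H := by ring
      _ ≤ B := hB
  exact ⟨h1, h2, h3, h4, h5⟩

/-! ### The infinite place: Theorem 3.2.8 for `K = ℚ`, `v = ∞`, from Theorem 3.2.4 (Matveev) -/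

/-- **Evertse–Győry, Theorem 3.2.8 for `K = ℚ` at the infinite place, from Theorem 3.2.4
(Matveev 2000, Cor. 2.3) for `K = ℚ`.**

The hypothesis `hM` is the printed statement of Theorem 3.2.4 (p. 61) in the case `K = ℚ`
(so `d = 1`, `K ⊂ ℝ` hence `χ = 1`, and `d² log(ed) = 1`), for positive rational numbers
`a₁, …, aₙ ≠ 1` (`n ≥ 2`) with `log aₖ` the real logarithm (a fixed non-zero value of the
logarithm): if `b₁, …, bₙ ∈ ℤ` are not all zero, `Σ = b₁ log a₁ + ⋯ + bₙ log aₙ ≠ 0`,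
`Aₖ ≥ max{h(aₖ), |log aₖ|, 0.16}` and `B ≥ max{1, maxₖ |bₖ| Aₖ / Aₙ}` (the printed `B` is this
maximum; the printed bound is monotone in `B`), then `log |Σ| > −C₁(n, 1) A₁ ⋯ Aₙ log(eB)` with
`C₁(n, 1) = min{(en/2) 30^{n+3} n^{3.5}, 2^{6n+20}}`; the distinguished index `n` is `k₀`.

The conclusion is the infinite-place half of Theorem 3.2.8 for `K = ℚ` exactly as it enters
`evertseGyory_thm_4_2_1_rat_of_thm_3_2_8` (`n − 1 = #ι ≥ 1` non-torsion `αᵢ ∈ ℚ*`, `αₙ = β ∈ ℚ*`,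
`bₙ = s = ±1`, `Λ = (∏ αᵢ^{bᵢ}) β^s − 1 ≠ 0`, `B ≥ max(|bᵢ|, 2e · 9ⁿ Θ H)`; conclusion
`log |Λ| > −C₆(n, 1) (2 / log 2) Θ H log*(2B / H)` with `N(∞) = 2`).
Proof (p. 63, simplified for `d = 1`): if `|Λ| > ½` the bound is trivial; otherwise
`P = 1 + Λ > 0`, `|log P| ≤ 2|Λ|`, and `log P = Σ bᵢ log |αᵢ| + s log |β|` is a non-zero linear
form in real logarithms of positive rationals, to which `hM` is applied on the index set
`Option ι` with `Aᵢ = h(αᵢ)`, `Aₙ = H`, the `n`-th slot being `(|β|, s)` if `|β| ≠ 1` and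
`(2, 0)` if `|β| = 1`, and with `(B/H)²` for Matveev's `B`; then `const_infinite_bound`.
[cite: EvertseGyory2015, Thm 3.2.4 (p. 61), Thm 3.2.8 (p. 62), proof p. 63] -/
theorem thm328_rat_infinite_of_matveev
    (hM : ∀ (κ : Type) [Fintype κ], 2 ≤ Fintype.card κ →
      ∀ (a : κ → ℚ) (b : κ → ℤ) (A : κ → ℝ) (k₀ : κ) (B : ℝ),
        (∀ k, 0 < a k ∧ a k ≠ 1) → b ≠ 0 →
        ∑ k, (b k : ℝ) * Real.log (a k : ℝ) ≠ 0 →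
        (∀ k, max (logHeight₁ (a k)) (max |Real.log (a k : ℝ)| 0.16) ≤ A k) →
        1 ≤ B → (∀ k, (|b k| : ℝ) * A k / A k₀ ≤ B) →
        -(min (Real.exp 1 * Fintype.card κ / 2 * 30 ^ (Fintype.card κ + 3) *
                (Fintype.card κ : ℝ) ^ (7 / 2 : ℝ))
              (2 ^ (6 * Fintype.card κ + 20)) *
            (∏ k, A k) * Real.log (Real.exp 1 * B)) <
          Real.log |∑ k, (b k : ℝ) * Real.log (a k : ℝ)|)
    (ι : Type) [Fintype ι] (hι : 0 < Fintype.card ι)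
    (α : ι → ℚ) (hα : ∀ i, α i ≠ 0 ∧ α i ≠ 1 ∧ α i ≠ -1)
    (β : ℚ) (hβ : β ≠ 0) (s : ℤ) (hs : s = 1 ∨ s = -1) (b : ι → ℤ)
    (hΛ : (∏ i, α i ^ b i) * β ^ s - 1 ≠ 0)
    (B : ℝ) (hbB : ∀ i, (|b i| : ℝ) ≤ B)
    (hB : 2 * Real.exp 1 * 9 ^ (Fintype.card ι + 1) * (∏ i, logHeight₁ (α i)) *
        max (logHeight₁ β) 1 ≤ B) :
    -(egC6 (Fintype.card ι + 1) * (2 / Real.log 2) * (∏ i, logHeight₁ (α i)) *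
          max (logHeight₁ β) 1 * logStar (B * 2 / max (logHeight₁ β) 1)) <
      Real.log |((((∏ i, α i ^ b i) * β ^ s - 1 : ℚ)) : ℝ)| := by
  classical
  set m := Fintype.card ι with hm
  set Θ := ∏ i, logHeight₁ (α i) with hΘ
  set H := max (logHeight₁ β) 1 with hH
  set L := logStar (B * 2 / H) with hL
  set P : ℚ := (∏ i, α i ^ b i) * β ^ s with hP
  have hm1 : 1 ≤ m := hι
  have hlog2 : 0 < Real.log 2 := Real.log_pos one_lt_two
  have hl2 : Real.log 2 ≤ 1 := by have := Real.log_two_lt_d9; linarith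
  have hhalf : (1 / 2 : ℝ) ≤ Real.log 2 := by have := Real.log_two_gt_d9; linarith
  have hhα : ∀ i, Real.log 2 ≤ logHeight₁ (α i) := fun i =>
    log_two_le_logHeight₁ (hα i).1 (hα i).2.1 (hα i).2.2
  have hΘlow : (1 / 2 : ℝ) ^ m ≤ Θ := half_pow_card_le_prod_logHeight₁ α hα
  have hΘpos : 0 < Θ := lt_of_lt_of_le (by positivity) hΘlow
  have hH1 : 1 ≤ H := le_max_right _ _
  have hH0 : 0 < H := by linarith
  have hL1 : 1 ≤ L := one_le_logStar _
  have he2 : (2 : ℝ) ≤ Real.exp 1 := by linarith [Real.add_one_le_exp (1 : ℝ)]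
  obtain ⟨h2mΘ, hBH1, hB1, hBpos, -⟩ := eg328_prelim m hΘlow hH1 hB
  -- the comparison of constants, and `R > 1`
  have hconst := const_infinite_bound m hm1 hΘlow hH1 hL1
  have hR1 : 1 < egC6 (m + 1) * (2 / Real.log 2) * Θ * H * L := by
    have hp : (2 : ℝ) ^ m * (1 / 2) ^ m = 1 := by rw [← mul_pow]; norm_num
    have h1 : (1 : ℝ) ≤ 2 ^ m * (Θ * H * L) := by
      calc (1 : ℝ) = 2 ^ m * (1 / 2) ^ m := hp.symm
        _ ≤ 2 ^ m * Θ := mul_le_mul_of_nonneg_left hΘlow (by positivity)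
        _ = 2 ^ m * (Θ * 1 * 1) := by ring
        _ ≤ 2 ^ m * (Θ * H * L) := by
            apply mul_le_mul_of_nonneg_left _ (by positivity)
            exact mul_le_mul (mul_le_mul_of_nonneg_left hH1 hΘpos.le) hL1 zero_le_one
              (by positivity)
    have h2 : (2 : ℝ) ^ m < 3 * 2 ^ (6 * (m + 1) + 20) := by
      have : (2 : ℝ) ^ m ≤ 2 ^ (6 * (m + 1) + 20) := pow_le_pow_right₀ one_le_two (by omega)
      have : (0 : ℝ) < 2 ^ (6 * (m + 1) + 20) := by positivity
      linarith
    have hΘHL : 0 < Θ * H * L := by positivity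
    have h3 : (1 : ℝ) < 3 * 2 ^ (6 * (m + 1) + 20) * Θ * H * L := by
      calc (1 : ℝ) ≤ 2 ^ m * (Θ * H * L) := h1
        _ < 3 * 2 ^ (6 * (m + 1) + 20) * (Θ * H * L) := mul_lt_mul_of_pos_right h2 hΘHL
        _ = _ := by ring
    linarith
  -- `Λ = P - 1` as a real number
  have hΛR : ((((∏ i, α i ^ b i) * β ^ s - 1 : ℚ)) : ℝ) = (P : ℝ) - 1 := by
    rw [hP]; push_cast; ring
  rw [hΛR]
  by_cases hbig : (1 / 2 : ℝ) < |(P : ℝ) - 1|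
  · -- trivial case `|Λ| > 1/2`
    have h1 : Real.log (1 / 2) < Real.log |(P : ℝ) - 1| :=
      Real.log_lt_log (by norm_num) hbig
    have h2 : Real.log (1 / 2) = -Real.log 2 := by
      rw [one_div, Real.log_inv]
    linarith
  push Not at hbig
  -- now `|P - 1| ≤ 1/2`, so `P ≥ 1/2 > 0`
  have hP0 : (1 / 2 : ℝ) ≤ (P : ℝ) := by linarith [(abs_le.mp hbig).1]
  have hPpos : (0 : ℝ) < (P : ℝ) := by linarith
  have hP1 : (P : ℝ) ≠ 1 := by
    intro h
    apply hΛ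
    have : ((((∏ i, α i ^ b i) * β ^ s - 1 : ℚ)) : ℝ) = 0 := by rw [hΛR, h, sub_self]
    exact_mod_cast this
  have hlogP : Real.log (P : ℝ) ≠ 0 := Real.log_ne_zero_of_pos_of_ne_one hPpos hP1
  -- the Matveev data on `Option ι`
  set c : ℚ := |β| with hc
  have hc0 : 0 < c := abs_pos.mpr hβ
  let a : Option ι → ℚ := fun k => k.elim (if c = 1 then 2 else c) (fun i => |α i|)
  let b' : Option ι → ℤ := fun k => k.elim (if c = 1 then 0 else s) b
  let A : Option ι → ℝ := fun k => k.elim H (fun i => logHeight₁ (α i))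
  have ha_some : ∀ i, a (some i) = |α i| := fun i => rfl
  have hb_some : ∀ i, b' (some i) = b i := fun i => rfl
  have hA_some : ∀ i, A (some i) = logHeight₁ (α i) := fun i => rfl
  have ha_none : a none = if c = 1 then 2 else c := rfl
  have hb_none : b' none = if c = 1 then 0 else s := rfl
  have hA_none : A none = H := rfl
  -- the linear form equals `log P`
  have hPR : (P : ℝ) = (∏ i, ((α i : ℚ) : ℝ) ^ b i) * ((β : ℚ) : ℝ) ^ s := by
    rw [hP]; push_cast; ring
  have hαR : ∀ i, ((α i : ℚ) : ℝ) ≠ 0 := fun i => by exact_mod_cast (hα i).1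
  have hβR : ((β : ℚ) : ℝ) ≠ 0 := by exact_mod_cast hβ
  have hlogabsP : Real.log (P : ℝ) =
      ∑ i, (b i : ℝ) * Real.log |((α i : ℚ) : ℝ)| + (s : ℝ) * Real.log |((β : ℚ) : ℝ)| := by
    rw [← Real.log_abs (P : ℝ), hPR, abs_mul, Finset.abs_prod,
      Real.log_mul (Finset.prod_ne_zero_iff.mpr fun i _ => by
        rw [abs_zpow]; exact zpow_ne_zero _ (abs_ne_zero.mpr (hαR i)))
        (by rw [abs_zpow]; exact zpow_ne_zero _ (abs_ne_zero.mpr hβR)),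
      Real.log_prod (s := univ) (fun i _ => by
        rw [abs_zpow]; exact zpow_ne_zero _ (abs_ne_zero.mpr (hαR i)))]
    congr 1
    · refine Finset.sum_congr rfl fun i _ => ?_
      rw [abs_zpow, Real.log_zpow]
    · rw [abs_zpow, Real.log_zpow]
  have hnone_term : (b' none : ℝ) * Real.log ((a none : ℚ) : ℝ) =
      (s : ℝ) * Real.log |((β : ℚ) : ℝ)| := by
    rw [ha_none, hb_none]
    split_ifs with h1
    · have : |((β : ℚ) : ℝ)| = 1 := by
        rw [← Rat.cast_abs, ← hc, h1]; norm_num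
      rw [this, Real.log_one]; simp
    · rw [hc, Rat.cast_abs]
  have hSum : ∑ k, (b' k : ℝ) * Real.log ((a k : ℚ) : ℝ) = Real.log (P : ℝ) := by
    rw [Fintype.sum_option, hlogabsP, hnone_term, add_comm]
    congr 1
    refine Finset.sum_congr rfl fun i _ => ?_
    rw [hb_some, ha_some, Rat.cast_abs]
  -- hypotheses of Theorem 3.2.4
  have hcard : 2 ≤ Fintype.card (Option ι) := by rw [Fintype.card_option]; omega
  have ha_pos : ∀ k, 0 < a k ∧ a k ≠ 1 := by
    rintro (_ | i)
    · rw [ha_none]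
      split_ifs with h1
      · norm_num
      · exact ⟨hc0, h1⟩
    · rw [ha_some]
      refine ⟨abs_pos.mpr (hα i).1, ?_⟩
      intro h
      rcases (abs_eq zero_le_one).mp h with h' | h'
      · exact (hα i).2.1 h'
      · exact (hα i).2.2 h'
  have hSumne : ∑ k, (b' k : ℝ) * Real.log ((a k : ℚ) : ℝ) ≠ 0 := by rwa [hSum]
  have hb'ne : b' ≠ 0 := by
    intro h0
    apply hSumne
    simp [h0]
  have h016 : (0.16 : ℝ) ≤ Real.log 2 := by have := Real.log_two_gt_d9; linarith
  have h016' : (0.16 : ℝ) ≤ 1 := by norm_num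
  have hAk : ∀ k, max (logHeight₁ (a k)) (max |Real.log ((a k : ℚ) : ℝ)| 0.16) ≤ A k := by
    rintro (_ | i)
    · rw [ha_none, hA_none]
      split_ifs with h1
      · refine max_le ?_ (max_le ?_ ?_)
        · rw [logHeight₁_two]; linarith
        · have h2 : ((2 : ℚ) : ℝ) = 2 := by norm_num
          rw [h2, abs_of_pos hlog2]; linarith
        · linarith
      · refine max_le ?_ (max_le ?_ ?_)
        · rw [hc, logHeight₁_abs]; exact le_max_left _ _
        · rw [hc, Rat.cast_abs]
          exact le_trans (abs_log_abs_le_logHeight₁ hβ) (le_max_left _ _)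
        · linarith
    · rw [ha_some, hA_some]
      refine max_le ?_ (max_le ?_ ?_)
      · rw [logHeight₁_abs]
      · rw [Rat.cast_abs]; exact abs_log_abs_le_logHeight₁ (hα i).1
      · linarith [hhα i]
  -- `h(αᵢ) ≤ 2^m Θ ≤ B/H`
  have hhi : ∀ i, logHeight₁ (α i) ≤ 2 ^ m * Θ := by
    intro i
    have hsplit : logHeight₁ (α i) * ∏ j ∈ univ.erase i, logHeight₁ (α j) = Θ := by
      rw [hΘ]; exact Finset.mul_prod_erase univ (fun j => logHeight₁ (α j)) (mem_univ i)
    have hrest : (1 / 2 : ℝ) ^ (m - 1) ≤ ∏ j ∈ univ.erase i, logHeight₁ (α j) := by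
      have : ∏ _j ∈ univ.erase i, (1 / 2 : ℝ) = (1 / 2) ^ (m - 1) := by
        rw [Finset.prod_const, Finset.card_erase_of_mem (mem_univ i), Finset.card_univ]
      rw [← this]
      exact Finset.prod_le_prod (fun j _ => by norm_num) fun j _ => le_trans hhalf (hhα j)
    have hhi0 : 0 ≤ logHeight₁ (α i) := zero_le_logHeight₁ _
    have h2m : (2 : ℝ) ^ m * (1 / 2) ^ (m - 1) = 2 := by
      have hk : m = (m - 1) + 1 := by omega
      calc (2 : ℝ) ^ m * (1 / 2) ^ (m - 1) = 2 ^ ((m - 1) + 1) * (1 / 2) ^ (m - 1) := by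
            rw [← hk]
        _ = 2 * (2 * (1 / 2)) ^ (m - 1) := by rw [pow_succ, mul_pow]; ring
        _ = 2 := by norm_num
    calc logHeight₁ (α i) = logHeight₁ (α i) * 1 := (mul_one _).symm
      _ ≤ logHeight₁ (α i) * (2 ^ m * (1 / 2) ^ (m - 1)) := by rw [h2m]; linarith
      _ = 2 ^ m * (logHeight₁ (α i) * (1 / 2) ^ (m - 1)) := by ring
      _ ≤ 2 ^ m * (logHeight₁ (α i) * ∏ j ∈ univ.erase i, logHeight₁ (α j)) := by
          apply mul_le_mul_of_nonneg_left _ (by positivity)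
          exact mul_le_mul_of_nonneg_left hrest hhi0
      _ = 2 ^ m * Θ := by rw [hsplit]
  have hBM1 : (1 : ℝ) ≤ (B / H) ^ 2 := one_le_pow₀ hBH1
  have hBMk : ∀ k, (|b' k| : ℝ) * A k / A none ≤ (B / H) ^ 2 := by
    rintro (_ | i)
    · rw [hA_none, mul_div_assoc, div_self hH0.ne', mul_one, hb_none]
      refine le_trans ?_ hBM1
      split_ifs
      · simp
      · rcases hs with h | h <;> simp [h]
    · rw [hb_some, hA_some, hA_none]
      have h1 : (|b i| : ℝ) * logHeight₁ (α i) ≤ B * (B / H) := by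
        have := hbB i
        calc (|b i| : ℝ) * logHeight₁ (α i) ≤ B * (2 ^ m * Θ) :=
              mul_le_mul this (hhi i) (zero_le_logHeight₁ _) hBpos.le
          _ ≤ B * (B / H) := mul_le_mul_of_nonneg_left h2mΘ hBpos.le
      calc (|b i| : ℝ) * logHeight₁ (α i) / H ≤ B * (B / H) / H :=
            div_le_div_of_nonneg_right h1 hH0.le
        _ = (B / H) ^ 2 := by ring
  -- apply Theorem 3.2.4
  have hMat := hM (Option ι) hcard a b' A none ((B / H) ^ 2) ha_pos hb'ne hSumne hAk hBM1 hBMk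
  have hprodA : ∏ k, A k = H * Θ :=
    calc ∏ k, A k = A none * ∏ i, A (some i) := Fintype.prod_option _
      _ = H * Θ := rfl
  rw [hSum, hprodA, Fintype.card_option] at hMat
  -- bound the constant and the logarithm
  have hlogBM : Real.log (Real.exp 1 * (B / H) ^ 2) ≤ 3 * L := by
    rw [Real.log_mul (Real.exp_pos 1).ne' (by positivity), Real.log_exp, Real.log_pow]
    have h1 : Real.log (B / H) ≤ L := by
      calc Real.log (B / H) ≤ Real.log (B * 2 / H) := by
            apply Real.log_le_log (by positivity)
            rw [show B * 2 / H = 2 * (B / H) by ring]; linarith [div_pos hBpos hH0]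
        _ ≤ L := le_max_right _ _
    push_cast
    linarith
  have hlogBM0 : 0 ≤ Real.log (Real.exp 1 * (B / H) ^ 2) := by
    apply Real.log_nonneg
    calc (1 : ℝ) ≤ Real.exp 1 := by linarith
      _ = Real.exp 1 * 1 := (mul_one _).symm
      _ ≤ Real.exp 1 * (B / H) ^ 2 := mul_le_mul_of_nonneg_left hBM1 (Real.exp_pos 1).le
  -- |Λ| ≥ |log P| / 2
  have hΛlow : Real.log |Real.log (P : ℝ)| - Real.log 2 ≤ Real.log |(P : ℝ) - 1| := by
    have h1 : |Real.log (P : ℝ)| ≤ 2 * |(P : ℝ) - 1| := by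
      -- `|log x| ≤ 2|x - 1|` for `|x - 1| ≤ 1/2`
      have hl1 : Real.log (P : ℝ) ≤ (P : ℝ) - 1 := Real.log_le_sub_one_of_pos hPpos
      have hl2 : 1 - (P : ℝ)⁻¹ ≤ Real.log (P : ℝ) := Real.one_sub_inv_le_log_of_pos hPpos
      rw [abs_le]
      constructor
      · have : -(2 * |(P : ℝ) - 1|) ≤ 1 - (P : ℝ)⁻¹ := by
          rcases le_or_gt 1 (P : ℝ) with hx1 | hx1
          · have : (P : ℝ)⁻¹ ≤ 1 := inv_le_one_of_one_le₀ hx1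
            have : 0 ≤ |(P : ℝ) - 1| := abs_nonneg _
            linarith
          · rw [abs_of_neg (by linarith)]
            have key : (P : ℝ)⁻¹ ≤ 3 - 2 * (P : ℝ) := by
              rw [inv_eq_one_div, div_le_iff₀ hPpos]
              nlinarith
            linarith
        linarith
      · linarith [le_abs_self ((P : ℝ) - 1), abs_nonneg ((P : ℝ) - 1)]
    have h2 : 0 < |Real.log (P : ℝ)| := abs_pos.mpr hlogP
    have h3 : Real.log |Real.log (P : ℝ)| ≤ Real.log (2 * |(P : ℝ) - 1|) :=
      Real.log_le_log h2 h1
    rw [Real.log_mul two_ne_zero (abs_ne_zero.mpr (sub_ne_zero.mpr hP1))] at h3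
    linarith
  -- generalize the constant `C₁(n, 1)` away
  suffices key : ∀ X : ℝ, X ≤ 2 ^ (6 * (m + 1) + 20) → 0 ≤ X →
      -(X * (H * Θ) * Real.log (Real.exp 1 * (B / H) ^ 2)) < Real.log |Real.log (P : ℝ)| →
      -(egC6 (m + 1) * (2 / Real.log 2) * Θ * H * L) < Real.log |(P : ℝ) - 1| by
    refine key _ (min_le_right _ _) (le_min ?_ ?_) hMat
    · have : (0 : ℝ) ≤ ((m + 1 : ℕ) : ℝ) ^ (7 / 2 : ℝ) := Real.rpow_nonneg (by positivity) _
      positivity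
    · positivity
  intro X hXle hX0 hMat'
  have hmain : X * (H * Θ) * Real.log (Real.exp 1 * (B / H) ^ 2) ≤
      3 * 2 ^ (6 * (m + 1) + 20) * Θ * H * L := by
    calc X * (H * Θ) * Real.log (Real.exp 1 * (B / H) ^ 2)
        ≤ 2 ^ (6 * (m + 1) + 20) * (H * Θ) * (3 * L) := by
          apply mul_le_mul _ hlogBM hlogBM0 (by positivity)
          exact mul_le_mul_of_nonneg_right hXle (by positivity)
      _ = _ := by ring
  linarith

/-! ### The finite places: Theorem 3.2.8 for `K = ℚ`, `v = p`, from Theorem 3.2.7 (Yu) -/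

/-- `C₃(n,1) = (16e)^{2(n+1)} n^{3/2} log(2n) log 2 ≥ 0` (`n ≥ 1`). [folklore] -/
theorem yuC3_nonneg (n : ℕ) (hn : 1 ≤ n) :
    0 ≤ (16 * Real.exp 1) ^ (2 * (n + 1)) * (n : ℝ) ^ (3 / 2 : ℝ) * Real.log (2 * n) *
      Real.log 2 := by
  have hn1 : (1 : ℝ) ≤ n := by exact_mod_cast hn
  have h1 : 0 ≤ (n : ℝ) ^ (3 / 2 : ℝ) := Real.rpow_nonneg (by positivity) _
  have h2 : 0 ≤ Real.log (2 * n) := Real.log_nonneg (by linarith)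
  have h3 : 0 ≤ Real.log 2 := Real.log_nonneg one_le_two
  positivity

/-- `C₅(n,1) = 2 e^{(n+1)(6n+5)} log 2 > 0`. [folklore] -/
theorem yuC5_pos (n : ℕ) : 0 < 2 * Real.exp 1 ^ ((n + 1) * (6 * n + 5)) * Real.log 2 := by
  have : 0 < Real.log 2 := Real.log_pos one_lt_two
  positivity

/-- `log C₅(n,1) ≤ (n+1)(6n+5) + 1`. [folklore] -/
theorem log_yuC5_le (n : ℕ) :
    Real.log (2 * Real.exp 1 ^ ((n + 1) * (6 * n + 5)) * Real.log 2) ≤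
      ((n : ℝ) + 1) * (6 * n + 5) + 1 := by
  have hlog2 : 0 < Real.log 2 := Real.log_pos one_lt_two
  have hl2 : Real.log 2 ≤ 1 := by have := Real.log_two_lt_d9; linarith
  rw [Real.log_mul (by positivity) hlog2.ne', Real.log_mul two_ne_zero (by positivity),
    Real.log_pow, Real.log_exp]
  have : Real.log (Real.log 2) ≤ 0 := Real.log_nonpos hlog2.le hl2
  push_cast
  linarith

/-- `C₄(n,1) = 2^{2n+1} log 2 (log 3)³ ≥ 1` for `n ≥ 2`. [folklore] -/
theorem one_le_yuC4 (n : ℕ) (hn : 2 ≤ n) :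
    (1 : ℝ) ≤ 2 ^ (2 * n + 1) * Real.log 2 * Real.log 3 ^ 3 := by
  have hhalf : (1 / 2 : ℝ) ≤ Real.log 2 := by have := Real.log_two_gt_d9; linarith
  have hl3 : 1 / 2 ≤ Real.log 3 := le_trans hhalf (Real.log_le_log two_pos (by norm_num))
  have h32 : (32 : ℝ) ≤ 2 ^ (2 * n + 1) := by
    calc (32 : ℝ) = 2 ^ 5 := by norm_num
      _ ≤ 2 ^ (2 * n + 1) := pow_le_pow_right₀ one_le_two (by omega)
  have h8 : (1 / 8 : ℝ) ≤ Real.log 3 ^ 3 := by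
    calc (1 / 8 : ℝ) = (1 / 2) ^ 3 := by norm_num
      _ ≤ Real.log 3 ^ 3 := pow_le_pow_left₀ (by norm_num) hl3 3
  calc (1 : ℝ) ≤ 32 * (1 / 2) * (1 / 8) := by norm_num
    _ ≤ 2 ^ (2 * n + 1) * Real.log 2 * Real.log 3 ^ 3 := by
        apply mul_le_mul (mul_le_mul h32 hhalf (by norm_num) (by positivity)) h8 (by norm_num)
          (by positivity)

/-- The "some computation" on p. 63 at a finite place, for `d = 1`, as an implication between
real numbers: from (3.2.6) with `Bₙ = 1`, `δ = Θ H / B`, `h'₁⋯h'ₙ = c Θ` with `0 < c = h'ₙ ≤ H`,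
`h'₁⋯h'ₙ₋₁ = Θ`, and the properties `C₃ (7(n+1)²) ≤ C₆(n,1)`, `log C₅ ≤ (n+1)(6n+5) + 1`,
`C₄ ≥ 1` of the constants, one gets `ord_p(Λ) log p < C₆(n,1) (p / log p) Θ H log*(pB/H)`.
[cite: EvertseGyory2015, proof of Thm 3.2.8 (p. 63)] -/
theorem finite_place_computation (n : ℕ) {Θ H B c C3 C4 C5 v : ℝ} {p : ℕ}
    (hp : 2 ≤ p) (hΘ : 0 < Θ) (hH : 1 ≤ H) (hBH : 1 ≤ B / H) (hB : 0 < B)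
    (hc0 : 0 < c) (hcH : c ≤ H)
    (hC30 : 0 ≤ C3) (hconst : C3 * (7 * ((n : ℝ) + 1) ^ 2) ≤ egC6 n)
    (hC50 : 0 < C5) (hlogC5 : Real.log C5 ≤ ((n : ℝ) + 1) * (6 * n + 5) + 1)
    (hC41 : 1 ≤ C4)
    (hv : v < C3 * (p / Real.log p ^ 2) *
        max (c * Θ * Real.log (1 * C5 * (p : ℝ) ^ (n + 1) * Θ / (Θ * H / B)))
          (Θ * H / B * B / (1 * C4))) :
    v * Real.log p < egC6 n * (p / Real.log p) * Θ * H * logStar (B * p / H) := by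
  set L := logStar (B * p / H) with hL
  have hL1 : 1 ≤ L := one_le_logStar _
  have hL0 : 0 ≤ L := by linarith
  have hH0 : 0 < H := by linarith
  have hp2 : (2 : ℝ) ≤ p := by exact_mod_cast hp
  have hp0 : (0 : ℝ) < p := by linarith
  have hlogp : 0 < Real.log p := Real.log_pos (by linarith)
  have hlogp' : Real.log p ≠ 0 := hlogp.ne'
  have hn0 : (0 : ℝ) ≤ (n : ℝ) + 1 := by positivity
  have hW0 : 0 ≤ 7 * ((n : ℝ) + 1) ^ 2 * L := by positivity
  -- `log(M/δ) ≤ 7 (n+1)² L`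
  have hMδ : Real.log (1 * C5 * (p : ℝ) ^ (n + 1) * Θ / (Θ * H / B)) ≤
      7 * ((n : ℝ) + 1) ^ 2 * L := by
    have heq : 1 * C5 * (p : ℝ) ^ (n + 1) * Θ / (Θ * H / B) = C5 * (p : ℝ) ^ (n + 1) * (B / H) := by
      field_simp
    rw [heq, Real.log_mul (by positivity) (by positivity),
      Real.log_mul hC50.ne' (by positivity), Real.log_pow]
    have hlogBH : 0 ≤ Real.log (B / H) := Real.log_nonneg hBH
    have hlogpBH : Real.log p + Real.log (B / H) ≤ L := by
      rw [← Real.log_mul hp0.ne' (by positivity), show (p : ℝ) * (B / H) = B * p / H by ring]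
      exact le_max_right _ _
    have h1 : ((n : ℝ) + 1) * Real.log p + Real.log (B / H) ≤ ((n : ℝ) + 1) * L := by
      have h11 : Real.log (B / H) ≤ ((n : ℝ) + 1) * Real.log (B / H) :=
        le_mul_of_one_le_left hlogBH (by linarith)
      calc ((n : ℝ) + 1) * Real.log p + Real.log (B / H)
          ≤ ((n : ℝ) + 1) * Real.log p + ((n : ℝ) + 1) * Real.log (B / H) := by linarith
        _ = ((n : ℝ) + 1) * (Real.log p + Real.log (B / H)) := by ring
        _ ≤ ((n : ℝ) + 1) * L := mul_le_mul_of_nonneg_left hlogpBH hn0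
    have hQ0 : (0 : ℝ) ≤ ((n : ℝ) + 1) * (6 * n + 5) + 1 := by positivity
    have h2 : ((n : ℝ) + 1) * (6 * n + 5) + 1 ≤ (((n : ℝ) + 1) * (6 * n + 5) + 1) * L :=
      le_mul_of_one_le_right hQ0 hL1
    have h3 : (((n : ℝ) + 1) * (6 * n + 5) + 1) * L + ((n : ℝ) + 1) * L ≤
        7 * ((n : ℝ) + 1) ^ 2 * L := by
      have h31 : (((n : ℝ) + 1) * (6 * n + 5) + 1) + ((n : ℝ) + 1) ≤ 7 * ((n : ℝ) + 1) ^ 2 := by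
        nlinarith
      calc (((n : ℝ) + 1) * (6 * n + 5) + 1) * L + ((n : ℝ) + 1) * L
          = ((((n : ℝ) + 1) * (6 * n + 5) + 1) + ((n : ℝ) + 1)) * L := by ring
        _ ≤ 7 * ((n : ℝ) + 1) ^ 2 * L := mul_le_mul_of_nonneg_right h31 hL0
    push_cast
    calc Real.log C5 + ((n : ℝ) + 1) * Real.log p + Real.log (B / H)
        ≤ (((n : ℝ) + 1) * (6 * n + 5) + 1) + (((n : ℝ) + 1) * Real.log p + Real.log (B / H)) := by
          linarith
      _ ≤ (((n : ℝ) + 1) * (6 * n + 5) + 1) * L + ((n : ℝ) + 1) * L := add_le_add h2 h1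
      _ ≤ 7 * ((n : ℝ) + 1) ^ 2 * L := h3
  -- the first term of the max
  have hT1 : c * Θ * Real.log (1 * C5 * (p : ℝ) ^ (n + 1) * Θ / (Θ * H / B)) ≤
      H * Θ * (7 * ((n : ℝ) + 1) ^ 2 * L) := by
    have hcΘ : 0 ≤ c * Θ := by positivity
    calc c * Θ * Real.log (1 * C5 * (p : ℝ) ^ (n + 1) * Θ / (Θ * H / B))
        ≤ c * Θ * (7 * ((n : ℝ) + 1) ^ 2 * L) := mul_le_mul_of_nonneg_left hMδ hcΘ
      _ ≤ H * Θ * (7 * ((n : ℝ) + 1) ^ 2 * L) := by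
          apply mul_le_mul_of_nonneg_right _ hW0
          exact mul_le_mul_of_nonneg_right hcH hΘ.le
  -- the second term of the max
  have hT2 : Θ * H / B * B / (1 * C4) ≤ H * Θ * (7 * ((n : ℝ) + 1) ^ 2 * L) := by
    have hδB : Θ * H / B * B = Θ * H := by field_simp
    rw [hδB, one_mul]
    have hΘH : 0 ≤ Θ * H := by positivity
    have h7 : (1 : ℝ) ≤ 7 * ((n : ℝ) + 1) ^ 2 * L := by
      have h71 : (1 : ℝ) ≤ ((n : ℝ) + 1) ^ 2 := one_le_pow₀ (by linarith)
      have h72 : (1 : ℝ) ≤ 7 * ((n : ℝ) + 1) ^ 2 := by linarith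
      exact le_trans hL1 (le_mul_of_one_le_left hL0 h72)
    calc Θ * H / C4 ≤ Θ * H := div_le_self hΘH hC41
      _ = H * Θ * 1 := by ring
      _ ≤ H * Θ * (7 * ((n : ℝ) + 1) ^ 2 * L) := mul_le_mul_of_nonneg_left h7 (by positivity)
  have hmax : max (c * Θ * Real.log (1 * C5 * (p : ℝ) ^ (n + 1) * Θ / (Θ * H / B)))
      (Θ * H / B * B / (1 * C4)) ≤ H * Θ * (7 * ((n : ℝ) + 1) ^ 2 * L) := max_le hT1 hT2
  -- combine
  have hordlt : v < C3 * (p / Real.log p ^ 2) * (H * Θ * (7 * ((n : ℝ) + 1) ^ 2 * L)) :=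
    lt_of_lt_of_le hv (mul_le_mul_of_nonneg_left hmax (by positivity))
  have hstep : C3 * (p / Real.log p ^ 2) * (H * Θ * (7 * ((n : ℝ) + 1) ^ 2 * L)) * Real.log p ≤
      egC6 n * (p / Real.log p) * Θ * H * L := by
    have heq : C3 * (p / Real.log p ^ 2) * (H * Θ * (7 * ((n : ℝ) + 1) ^ 2 * L)) * Real.log p =
        C3 * (7 * ((n : ℝ) + 1) ^ 2) * ((p / Real.log p) * Θ * H * L) := by
      field_simp
    rw [heq]
    calc C3 * (7 * ((n : ℝ) + 1) ^ 2) * ((p / Real.log p) * Θ * H * L)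
        ≤ egC6 n * ((p / Real.log p) * Θ * H * L) :=
          mul_le_mul_of_nonneg_right hconst (by positivity)
      _ = _ := by ring
  have hmul : v * Real.log p <
      C3 * (p / Real.log p ^ 2) * (H * Θ * (7 * ((n : ℝ) + 1) ^ 2 * L)) * Real.log p :=
    mul_lt_mul_of_pos_right hordlt hlogp
  linarith

/-- **Evertse–Győry, Theorem 3.2.8 for `K = ℚ` at a finite place `p`, from Theorem 3.2.7
(Yu 2007) for `K = ℚ`.**

The hypothesis `hY` is the printed statement of Theorem 3.2.7 (p. 62) in the case `K = ℚ`
(so `d = 1`, `𝔭 = p` a prime number, `e_𝔭 = f_𝔭 = 1`, `N(𝔭) = p`): for `α₁, …, αₙ ∈ ℚ*`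
(`n ≥ 2`), `b₁, …, bₙ ∈ ℤ` with `bₙ ≠ 0` and `ord_p bₙ ≤ ord_p bᵢ` for all `i` with `bᵢ ≠ 0`
(for `bᵢ = 0` the printed condition `ord_p bₙ ≤ ord_p bᵢ = ∞` is void, and `bₙ = 0` would force
all `bᵢ = 0`, i.e. `Λ = 0`), reals `B ≥ max |bᵢ|`, `B ≥ Bₙ ≥ |bₙ|`,
`h'ᵢ = max{h(αᵢ), 1/(16e²)}`, `Λ = α₁^{b₁} ⋯ αₙ^{bₙ} − 1 ≠ 0` and any real `0 < δ ≤ ½`: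
`ord_p Λ < C₃(n,1) (p / (log p)²) max{h'₁⋯h'ₙ log(M δ⁻¹), δB / (Bₙ C₄(n,1))}` with
`C₃(n,1) = (16e)^{2(n+1)} n^{3/2} log(2n) log 2`, `C₄(n,1) = 2^{2n+1} log 2 (log 3)³`,
`M = Bₙ C₅(n,1) p^{n+1} h'₁ ⋯ h'ₙ₋₁`, `C₅(n,1) = 2 e^{(n+1)(6n+5)} log 2`; the distinguished
index `n` is `k₀` and `h'₁ ⋯ h'ₙ₋₁` is the product over `k ≠ k₀`.

The conclusion is the finite-place half of Theorem 3.2.8 for `K = ℚ` exactly as it enters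
`evertseGyory_thm_4_2_1_rat_of_thm_3_2_8` (notation as in `thm328_rat_infinite_of_matveev`;
conclusion `−ord_p(Λ) log p > −C₆(n, 1) (p / log p) Θ H log*(pB / H)`).
Proof (p. 63): apply `hY` on `Option ι` with `αₙ = β`, `bₙ = s`, `Bₙ = 1`, `δ = Θ H / B`
(`≤ ½` by (3.2.7)); then `h'ᵢ = h(αᵢ)` for `i < n` (Prop 3.2.9), `0 < h'ₙ ≤ H`, and
`finite_place_computation` (`M/δ = C₅ p^{n+1} B / H`, `log(M/δ) ≤ 7(n+1)² log*(pB/H)`,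
`δB / C₄ = ΘH / C₄ ≤ Θ H`, `C₃(n,1) · 7(n+1)² ≤ C₆(n,1)` by `const_finite_bound`).
[cite: EvertseGyory2015, Thm 3.2.7 (p. 62), Thm 3.2.8 (p. 62), proof p. 63] -/
theorem thm328_rat_finite_of_yu
    (hY : ∀ (κ : Type) [Fintype κ] [DecidableEq κ], 2 ≤ Fintype.card κ →
      ∀ (α : κ → ℚ) (b : κ → ℤ) (k₀ : κ) (B Bn δ : ℝ) (p : ℕ), p.Prime →
        (∀ k, α k ≠ 0) → b k₀ ≠ 0 →
        (∀ k, b k ≠ 0 → padicValInt p (b k₀) ≤ padicValInt p (b k)) →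
        (∀ k, (|b k| : ℝ) ≤ B) → Bn ≤ B → (|b k₀| : ℝ) ≤ Bn →
        ∏ k, α k ^ b k - 1 ≠ 0 → 0 < δ → δ ≤ 1 / 2 →
        (padicValRat p (∏ k, α k ^ b k - 1) : ℝ) <
          (16 * Real.exp 1) ^ (2 * (Fintype.card κ + 1)) * (Fintype.card κ : ℝ) ^ (3 / 2 : ℝ) *
              Real.log (2 * Fintype.card κ) * Real.log 2 *
            (p / Real.log p ^ 2) *
            max ((∏ k, max (logHeight₁ (α k)) (1 / (16 * Real.exp 1 ^ 2))) *
                  Real.log (Bn * (2 * Real.exp 1 ^ ((Fintype.card κ + 1) *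
                      (6 * Fintype.card κ + 5)) * Real.log 2) * (p : ℝ) ^ (Fintype.card κ + 1) *
                    (∏ k ∈ univ.erase k₀, max (logHeight₁ (α k)) (1 / (16 * Real.exp 1 ^ 2))) /
                    δ))
              (δ * B / (Bn * (2 ^ (2 * Fintype.card κ + 1) * Real.log 2 * Real.log 3 ^ 3))))
    (ι : Type) [Fintype ι] (hι : 0 < Fintype.card ι)
    (α : ι → ℚ) (hα : ∀ i, α i ≠ 0 ∧ α i ≠ 1 ∧ α i ≠ -1)
    (β : ℚ) (hβ : β ≠ 0) (s : ℤ) (hs : s = 1 ∨ s = -1) (b : ι → ℤ)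
    (hΛ : (∏ i, α i ^ b i) * β ^ s - 1 ≠ 0)
    (B : ℝ) (hbB : ∀ i, (|b i| : ℝ) ≤ B)
    (hB : 2 * Real.exp 1 * 9 ^ (Fintype.card ι + 1) * (∏ i, logHeight₁ (α i)) *
        max (logHeight₁ β) 1 ≤ B)
    (p : ℕ) (hp : p.Prime) :
    -(egC6 (Fintype.card ι + 1) * (p / Real.log p) * (∏ i, logHeight₁ (α i)) *
          max (logHeight₁ β) 1 * logStar (B * p / max (logHeight₁ β) 1)) <
      -(padicValRat p ((∏ i, α i ^ b i) * β ^ s - 1) : ℝ) * Real.log p := by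
  classical
  set m := Fintype.card ι with hm
  set Θ := ∏ i, logHeight₁ (α i) with hΘ
  set H := max (logHeight₁ β) 1 with hH
  have hlog2 : 0 < Real.log 2 := Real.log_pos one_lt_two
  have hl2 : Real.log 2 ≤ 1 := by have := Real.log_two_lt_d9; linarith
  have hhalf : (1 / 2 : ℝ) ≤ Real.log 2 := by have := Real.log_two_gt_d9; linarith
  have hhα : ∀ i, Real.log 2 ≤ logHeight₁ (α i) := fun i =>
    log_two_le_logHeight₁ (hα i).1 (hα i).2.1 (hα i).2.2
  have hΘlow : (1 / 2 : ℝ) ^ m ≤ Θ := half_pow_card_le_prod_logHeight₁ α hα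
  have hΘpos : 0 < Θ := lt_of_lt_of_le (by positivity) hΘlow
  have hH1 : 1 ≤ H := le_max_right _ _
  have hH0 : 0 < H := by linarith
  have he2 : (2 : ℝ) ≤ Real.exp 1 := by linarith [Real.add_one_le_exp (1 : ℝ)]
  obtain ⟨-, hBH1, hB1, hBpos, h2ΘH⟩ := eg328_prelim m hΘlow hH1 hB
  -- the data for Theorem 3.2.7 on `Option ι`
  let α' : Option ι → ℚ := fun k => k.elim β α
  let b' : Option ι → ℤ := fun k => k.elim s b
  have hα'_none : α' none = β := rfl
  have hb'_none : b' none = s := rfl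
  have hcard : 2 ≤ Fintype.card (Option ι) := by rw [Fintype.card_option]; omega
  have hα' : ∀ k, α' k ≠ 0 := by
    rintro (_ | i)
    · exact hβ
    · exact (hα i).1
  have hs0 : s ≠ 0 := by rcases hs with h | h <;> simp [h]
  have hb'0 : b' none ≠ 0 := hs0
  have hord : ∀ k, b' k ≠ 0 → padicValInt p (b' none) ≤ padicValInt p (b' k) := by
    intro k _
    have : padicValInt p (b' none) = 0 := by
      rw [hb'_none]
      rcases hs with h | h <;> simp [h, padicValInt]
    rw [this]; exact Nat.zero_le _
  have hb'B : ∀ k, (|b' k| : ℝ) ≤ B := by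
    rintro (_ | i)
    · rw [hb'_none]
      rcases hs with h | h <;> simp [h] <;> exact hB1
    · exact hbB i
  have hbn : (|b' none| : ℝ) ≤ 1 := by
    rw [hb'_none]
    rcases hs with h | h <;> simp [h]
  have hprodΛ : ∏ k, α' k ^ b' k - 1 = (∏ i, α i ^ b i) * β ^ s - 1 := by
    rw [Fintype.prod_option]
    show β ^ s * (∏ i, α i ^ b i) - 1 = _
    rw [mul_comm]
  have hΛ' : ∏ k, α' k ^ b' k - 1 ≠ 0 := by rwa [hprodΛ]
  have hδ0 : 0 < Θ * H / B := by positivity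
  have hδhalf : Θ * H / B ≤ 1 / 2 := by
    rw [div_le_iff₀ hBpos]; linarith
  -- apply Theorem 3.2.7
  have hYu := hY (Option ι) hcard α' b' none B 1 (Θ * H / B) p hp hα' hb'0 hord hb'B hB1 hbn hΛ'
    hδ0 hδhalf
  -- the heights `h'`
  have h16 : 1 / (16 * Real.exp 1 ^ 2) ≤ Real.log 2 := by
    have h4 : (4 : ℝ) ≤ Real.exp 1 ^ 2 := by nlinarith
    calc 1 / (16 * Real.exp 1 ^ 2) ≤ 1 / (16 * 4) := by
          apply one_div_le_one_div_of_le (by norm_num); linarith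
      _ ≤ 1 / 2 := by norm_num
      _ ≤ Real.log 2 := hhalf
  have hh'some : ∀ i, max (logHeight₁ (α' (some i))) (1 / (16 * Real.exp 1 ^ 2)) =
      logHeight₁ (α i) := fun i => max_eq_left (le_trans h16 (hhα i))
  have hh'none : max (logHeight₁ (α' none)) (1 / (16 * Real.exp 1 ^ 2)) ≤ H := by
    rw [hα'_none]
    exact max_le (le_max_left _ _) (le_trans (le_trans h16 hl2) hH1)
  have hh'none0 : 0 < max (logHeight₁ (α' none)) (1 / (16 * Real.exp 1 ^ 2)) :=
    lt_max_of_lt_right (by positivity)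
  have hprodh' : ∏ k, max (logHeight₁ (α' k)) (1 / (16 * Real.exp 1 ^ 2)) =
      max (logHeight₁ (α' none)) (1 / (16 * Real.exp 1 ^ 2)) * Θ := by
    rw [Fintype.prod_option]
    congr 1
    exact Finset.prod_congr rfl fun i _ => hh'some i
  have hprod_erase :
      ∏ k ∈ univ.erase none, max (logHeight₁ (α' k)) (1 / (16 * Real.exp 1 ^ 2)) = Θ := by
    have h := Finset.prod_erase_mul (univ : Finset (Option ι))
      (fun k => max (logHeight₁ (α' k)) (1 / (16 * Real.exp 1 ^ 2))) (mem_univ none)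
    rw [hprodh'] at h
    exact mul_right_cancel₀ hh'none0.ne' (h.trans (mul_comm _ _))
  rw [hprodΛ, hprodh', hprod_erase] at hYu
  -- from now on `n = #ι + 1 = card (Option ι)`
  obtain ⟨n, hn⟩ : ∃ n : ℕ, Fintype.card (Option ι) = n := ⟨_, rfl⟩
  have hnm : n = m + 1 := by rw [← hn, Fintype.card_option]
  have hn2 : 2 ≤ n := hn ▸ hcard
  rw [hn] at hYu
  have key := finite_place_computation n hp.two_le hΘpos hH1 hBH1 hBpos hh'none0 hh'none
    (yuC3_nonneg n (le_trans one_le_two hn2)) (const_finite_bound n hn2) (yuC5_pos n)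
    (log_yuC5_le n) (one_le_yuC4 n hn2) hYu
  rw [← hnm]
  linarith

/-! ### Assembly: Theorem 4.2.1 over `ℚ` from the theorems of Matveev and Yu over `ℚ` -/

/-- **Evertse–Győry, Theorem 4.2.1 for `K = ℚ`, conditional on Theorem 3.2.4 (Matveev 2000,
Cor. 2.3) and Theorem 3.2.7 (Yu 2007) for `K = ℚ`.** The hypotheses `hM` and `hY` are the
printed statements of Theorems 3.2.4 and 3.2.7 (pp. 61–62) in the case `K = ℚ`, as described in
the docstrings of `thm328_rat_infinite_of_matveev` and `thm328_rat_finite_of_yu`; the conclusion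
is the named fact `evertseGyory_thm_4_2_1_rat`. Proof: Theorem 3.2.8 for `K = ℚ` from `hM` and
`hY` (the two theorems above, i.e. the book's proof on p. 63 for `d = 1`), then
`evertseGyory_thm_4_2_1_rat_of_thm_3_2_8` (the book's §4.4, pp. 80–81, proved in the companion
files). Thus the only unproved inputs left under `evertseGyory_thm_4_2_1_rat` are Matveev's and
Yu's theorems.
[cite: EvertseGyory2015, Thm 3.2.4 (p. 61), Thm 3.2.7 (p. 62), Thm 4.2.1 (p. 68)] -/
theorem evertseGyory_thm_4_2_1_rat_of_matveev_yu
    (hM : ∀ (κ : Type) [Fintype κ], 2 ≤ Fintype.card κ →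
      ∀ (a : κ → ℚ) (b : κ → ℤ) (A : κ → ℝ) (k₀ : κ) (B : ℝ),
        (∀ k, 0 < a k ∧ a k ≠ 1) → b ≠ 0 →
        ∑ k, (b k : ℝ) * Real.log (a k : ℝ) ≠ 0 →
        (∀ k, max (logHeight₁ (a k)) (max |Real.log (a k : ℝ)| 0.16) ≤ A k) →
        1 ≤ B → (∀ k, (|b k| : ℝ) * A k / A k₀ ≤ B) →
        -(min (Real.exp 1 * Fintype.card κ / 2 * 30 ^ (Fintype.card κ + 3) *
                (Fintype.card κ : ℝ) ^ (7 / 2 : ℝ))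
              (2 ^ (6 * Fintype.card κ + 20)) *
            (∏ k, A k) * Real.log (Real.exp 1 * B)) <
          Real.log |∑ k, (b k : ℝ) * Real.log (a k : ℝ)|)
    (hY : ∀ (κ : Type) [Fintype κ] [DecidableEq κ], 2 ≤ Fintype.card κ →
      ∀ (α : κ → ℚ) (b : κ → ℤ) (k₀ : κ) (B Bn δ : ℝ) (p : ℕ), p.Prime →
        (∀ k, α k ≠ 0) → b k₀ ≠ 0 →
        (∀ k, b k ≠ 0 → padicValInt p (b k₀) ≤ padicValInt p (b k)) →
        (∀ k, (|b k| : ℝ) ≤ B) → Bn ≤ B → (|b k₀| : ℝ) ≤ Bn →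
        ∏ k, α k ^ b k - 1 ≠ 0 → 0 < δ → δ ≤ 1 / 2 →
        (padicValRat p (∏ k, α k ^ b k - 1) : ℝ) <
          (16 * Real.exp 1) ^ (2 * (Fintype.card κ + 1)) * (Fintype.card κ : ℝ) ^ (3 / 2 : ℝ) *
              Real.log (2 * Fintype.card κ) * Real.log 2 *
            (p / Real.log p ^ 2) *
            max ((∏ k, max (logHeight₁ (α k)) (1 / (16 * Real.exp 1 ^ 2))) *
                  Real.log (Bn * (2 * Real.exp 1 ^ ((Fintype.card κ + 1) *
                      (6 * Fintype.card κ + 5)) * Real.log 2) * (p : ℝ) ^ (Fintype.card κ + 1) *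
                    (∏ k ∈ univ.erase k₀, max (logHeight₁ (α k)) (1 / (16 * Real.exp 1 ^ 2))) /
                    δ))
              (δ * B / (Bn * (2 ^ (2 * Fintype.card κ + 1) * Real.log 2 * Real.log 3 ^ 3)))) :
    evertseGyory_thm_4_2_1_rat :=
  evertseGyory_thm_4_2_1_rat_of_thm_3_2_8 fun ι _ hι α hα β hβ s hs b hΛ B hbB hB =>
    ⟨thm328_rat_infinite_of_matveev hM ι hι α hα β hβ s hs b hΛ B hbB hB,
      fun p hp => thm328_rat_finite_of_yu hY ι hι α hα β hβ s hs b hΛ B hbB hB p hp⟩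

end Literature.NumberTheory.DiophantineGeometry.Dioph

end
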